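import Summits.Parity.GeneralizedHardyLittlewood.Theorems.PrimeLevelFamEdgeMomentsBeyondDiagonalDictionaryAtOne
import Summits.Parity.GeneralizedHardyLittlewood.Theorems.BeyondDiagonalBeatsQuarter.PeterssonSplit
import Literature.NumberTheory.LFunctions.KMVExactAFEAllOrdersProofs
import HarnessLib

/-!
# Route `PrimeLevelFamEdge`, crux K_A `MomentsBeyondDiagonal` (stmt-Parity-20007), line «petersson_layers» v4,
# registered stub `stub_diag : SubDiag` — THE DIAGONAL PART IN LINE COORDINATES (KMV (23)) AT EVERY ORDER `(i, j)`

`SubDiag` asks for an asymptotic of the explicit diagonal part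
`diagPart q P Q Δ' = Σ_{i,j ≤ deg Q} QᵢQⱼ ℓ^{−(i+j)} (1+(−1)^{i+j}) q̂ Σ_{n₁,n₂ ≤ q²} (n₁n₂)^{−1/2} W_{ij}(q̂;n₁,n₂)
 Σ_{m₁,m₂ ≤ M} x_{m₁}x_{m₂} Σ_{d₁∣(m₁,n₁)} Σ_{d₂∣(m₂,n₂)} δ(m₁n₁/d₁², m₂n₂/d₂²)` (deck 21a, `M = q̂^{Δ'}`).
Kowalski–Michel–VanderKam evaluate the diagonal after the substitution of p. 13 («let `c = (m₁, m₂)`, so that `n₁` and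
`n₂` must be proportional to `m₂/c` and `m₁/c` … `n₁ = n m₂/c`, `n₂ = n m₁/c`», display (23)). This file performs that
substitution IN THE KERNEL, at every order `(i, j)` and with the AFE box `nᵢ ≤ q²` kept exact:

* §1 `sum_box_ite_line_eq` — for a mollifier pair `(a, b)` and Hecke divisors `d₁ ∣ a`, `d₂ ∣ b`, the box points
  `(n₁, n₂) ∈ [1,N]²` with `d₁ ∣ n₁`, `d₂ ∣ n₂`, `a n₁/d₁² = b n₂/d₂²` are EXACTLY the points `t ↦ (d₁e₁t, d₂e₂t)`,
  `e₁ = (b/d₂)/c`, `e₂ = (a/d₁)/c`, `c = gcd(a/d₁, b/d₂)`, with `t ≥ 1` and both coordinates `≤ N`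
  (the line lemmas `line_cond` / `line_complete` of the K_B helpers `…BeyondDiagonalBeatsQuarter.PeterssonSplit{DiagLine,}`);
  `sum_pair_box_diag_eq_lines` — hence, for ANY weight `F(n₁, n₂)`,
  `Σ_{n₁,n₂ ≤ N} F(n₁,n₂) Σ_{d₁∣(a,n₁)} Σ_{d₂∣(b,n₂)} δ(a n₁/d₁², b n₂/d₂²) = Σ_{d₁∣a} Σ_{d₂∣b} Σ_{t : d₁e₁t, d₂e₂t ≤ N} F(d₁e₁t, d₂e₂t)`.
* §2 `weight_line_eq_logCutoffW` — along the line the order-`(i,j)` AFE weight is, in closed real form,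
  `(n₁n₂)^{−1/2} W_{ij}(q̂; n₁, n₂) = c (ab)^{−1/2} t⁻¹ · 𝒲_{ij}(log(q̂/(d₁e₁)) − log t, log(q̂/(d₂e₂)) − log t; K t²/q̂²)`,
  `K = (a/c)(b/c)`, `𝒲_{ij} = KMV2000.logCutoffW i j`
  (the tree's real form `KMV2000.afeW_eq_logCutoffW` and `line_prod`). At `i = j = 0` this is the summand of
  `PeterssonSplit.hasSum_afeWeight_line`.
* §3 `diagPart_eq_sum_lines` — `diagPart` itself in line coordinates:
  `diagPart = Σ_{i,j} QᵢQⱼ ℓ^{−(i+j)}(1+(−1)^{i+j}) q̂ Σ_{m₁,m₂ ≤ M} x_{m₁}x_{m₂} Σ_{d₁∣m₁} Σ_{d₂∣m₂} Σ_{t} (n₁n₂)^{−1/2}W_{ij}(q̂;n₁,n₂)|_{line}`.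

Exact identities only (no estimate, no asymptotic); every `Q`, every `P`, every `Δ'`. What remains for `stub_diag` after this
file: the `t`-sum asymptotics of `𝒲_{ij}` (Euler–Maclaurin inside the real form), the two-variable Möbius sums (KMV (24)–(29) in
real variables, cf. the `X²`/`Q = 1` kernel-form files of K_B), and the box tail. Helper `--supports stmt-Parity-20007`; closes
nothing; K_A, K_B and the Parity summit are NOT proved; nothing about Landau–Siegel zeros.
-/

noncomputable section

open scoped Real
open Complex Finset Polynomial
open Literature.NumberTheory.LFunctions

namespace Summit.Parity.GeneralizedHardyLittlewood.Theorems.MomentsBeyondDiagonal.DiagLines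

open Summit.Parity.GeneralizedHardyLittlewood.Theorems.PrimeLevelFamEdgeIdeaDeltas.PeterssonLayers
  (spectralSum afeBox diagKernel diagPart afeW_eq_kmv)
open Summit.Parity.GeneralizedHardyLittlewood.Theorems.BeyondDiagonalBeatsQuarter.PeterssonSplit
  (mul_mul_div_sq line_cond line_complete line_prod divisors_gcd_eq_filter)

/-! ## §1. The box points of one diagonal line -/

/-- The Hecke–Petersson diagonal count of a pair `(a, b)` at `(n₁, n₂)`, opened into indicators over `d₁ ∣ a`, `d₂ ∣ b`:
`Σ_{d₁∣(a,n₁)} Σ_{d₂∣(b,n₂)} δ(a n₁/d₁², b n₂/d₂²) = Σ_{d₁∣a} Σ_{d₂∣b} 𝟙[d₁ ∣ n₁, d₂ ∣ n₂, a n₁/d₁² = b n₂/d₂²]` (`a, b ≠ 0`).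
[cite: KowalskiMichelVanderKam2000, (21)–(23) p. 12–13 — derivation] -/
theorem sum_gcd_divisors_diagKernel_eq {a b : ℕ} (ha : a ≠ 0) (hb : b ≠ 0) (n₁ n₂ : ℕ) :
    ∑ d₁ ∈ (a.gcd n₁).divisors, ∑ d₂ ∈ (b.gcd n₂).divisors, diagKernel (a * n₁ / d₁ ^ 2) (b * n₂ / d₂ ^ 2) =
      ∑ d₁ ∈ a.divisors, ∑ d₂ ∈ b.divisors,
        (if d₁ ∣ n₁ ∧ d₂ ∣ n₂ ∧ a * n₁ / d₁ ^ 2 = b * n₂ / d₂ ^ 2 then (1 : ℂ) else 0) := by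
  classical
  rw [divisors_gcd_eq_filter ha, divisors_gcd_eq_filter hb, Finset.sum_filter]
  refine Finset.sum_congr rfl fun d₁ _ ↦ ?_
  rw [Finset.sum_filter]
  by_cases h₁ : d₁ ∣ n₁
  · rw [if_pos h₁]
    refine Finset.sum_congr rfl fun d₂ _ ↦ ?_
    by_cases h₂ : d₂ ∣ n₂
    · simp only [diagKernel, h₁, h₂, true_and, if_true]
    · simp only [h₂, false_and, and_false, if_false]
  · rw [if_neg h₁]
    symm
    refine Finset.sum_eq_zero fun d₂ _ ↦ ?_
    simp only [h₁, false_and, if_false]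

/-- **§1. The box points of one diagonal line.** For `a, b ≠ 0`, `d₁ ∣ a`, `d₂ ∣ b` and any weight `F`, with
`c = gcd(a/d₁, b/d₂)`, `e₁ = (b/d₂)/c`, `e₂ = (a/d₁)/c`:
`Σ_{n₁,n₂ ∈ [1,N]} 𝟙[d₁ ∣ n₁, d₂ ∣ n₂, a n₁/d₁² = b n₂/d₂²] F(n₁,n₂) = Σ_{1 ≤ t ≤ N : d₁e₁t ≤ N, d₂e₂t ≤ N} F(d₁e₁t, d₂e₂t)`
(KMV p. 13: «`n₁` and `n₂` must be proportional to `m₂/c` and `m₁/c`»). [cite: KowalskiMichelVanderKam2000, (23) p. 13 — derivation] -/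
theorem sum_box_ite_line_eq {a b d₁ d₂ : ℕ} (ha : a ≠ 0) (hb : b ≠ 0) (hd₁ : d₁ ∣ a) (hd₂ : d₂ ∣ b) (N : ℕ)
    (F : ℕ → ℕ → ℂ) :
    ∑ n₁ ∈ Icc 1 N, ∑ n₂ ∈ Icc 1 N,
        (if d₁ ∣ n₁ ∧ d₂ ∣ n₂ ∧ a * n₁ / d₁ ^ 2 = b * n₂ / d₂ ^ 2 then F n₁ n₂ else 0) =
      ∑ t ∈ (Icc 1 N).filter (fun t ↦ d₁ * ((b / d₂ / (a / d₁).gcd (b / d₂)) * t) ≤ N ∧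
          d₂ * ((a / d₁ / (a / d₁).gcd (b / d₂)) * t) ≤ N),
        F (d₁ * ((b / d₂ / (a / d₁).gcd (b / d₂)) * t)) (d₂ * ((a / d₁ / (a / d₁).gcd (b / d₂)) * t)) := by
  classical
  have hd₁0 : d₁ ≠ 0 := fun h ↦ ha (Nat.eq_zero_of_zero_dvd (h ▸ hd₁))
  have hd₂0 : d₂ ≠ 0 := fun h ↦ hb (Nat.eq_zero_of_zero_dvd (h ▸ hd₂))
  set a₁ := a / d₁ with ha₁
  set a₂ := b / d₂ with ha₂
  have ha₁0 : a₁ ≠ 0 := fun h ↦ ha (Nat.eq_zero_of_dvd_of_div_eq_zero hd₁ h)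
  have ha₂0 : a₂ ≠ 0 := fun h ↦ hb (Nat.eq_zero_of_dvd_of_div_eq_zero hd₂ h)
  set c := a₁.gcd a₂ with hc
  set e₁ := a₂ / c with he₁
  set e₂ := a₁ / c with he₂
  have he₁0 : e₁ ≠ 0 := fun h ↦ ha₂0 (Nat.eq_zero_of_dvd_of_div_eq_zero (Nat.gcd_dvd_right _ _) h)
  have he₂0 : e₂ ≠ 0 := fun h ↦ ha₁0 (Nat.eq_zero_of_dvd_of_div_eq_zero (Nat.gcd_dvd_left _ _) h)
  set g : ℕ → ℕ × ℕ := fun t ↦ (d₁ * (e₁ * t), d₂ * (e₂ * t)) with hg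
  have hde₁ : 0 < d₁ * e₁ := Nat.pos_of_ne_zero (mul_ne_zero hd₁0 he₁0)
  have hde₂ : 0 < d₂ * e₂ := Nat.pos_of_ne_zero (mul_ne_zero hd₂0 he₂0)
  have hg_inj : Function.Injective g := by
    intro s t hst
    have h1 := congrArg Prod.fst hst
    simp only [hg] at h1
    rw [← mul_assoc, ← mul_assoc] at h1
    exact Nat.eq_of_mul_eq_mul_left hde₁ h1
  set T : Finset ℕ := (Icc 1 N).filter (fun t ↦ d₁ * (e₁ * t) ≤ N ∧ d₂ * (e₂ * t) ≤ N) with hT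
  -- the box points on the line are the image of `T`
  have himage : (Icc 1 N ×ˢ Icc 1 N).filter
      (fun n : ℕ × ℕ ↦ d₁ ∣ n.1 ∧ d₂ ∣ n.2 ∧ a * n.1 / d₁ ^ 2 = b * n.2 / d₂ ^ 2) = T.image g := by
    ext ⟨n₁, n₂⟩
    simp only [Finset.mem_filter, Finset.mem_product, Finset.mem_Icc, Finset.mem_image, hT, hg, Prod.mk.injEq]
    constructor
    · rintro ⟨⟨⟨h1l, h1u⟩, ⟨-, h2u⟩⟩, hdn₁, hdn₂, heq⟩
      obtain ⟨t, ht₁, ht₂⟩ := line_complete hd₁ hd₂ ha hb hdn₁ hdn₂ heq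
      have ht0 : t ≠ 0 := by
        rintro rfl
        simp only [mul_zero] at ht₁
        omega
      refine ⟨t, ⟨⟨Nat.one_le_iff_ne_zero.mpr ht0, ?_⟩, ?_, ?_⟩, ht₁.symm, ht₂.symm⟩
      · calc t ≤ d₁ * e₁ * t := Nat.le_mul_of_pos_left t hde₁
          _ = n₁ := by rw [mul_assoc, ← ht₁]
          _ ≤ N := h1u
      · rw [← ht₁]; exact h1u
      · rw [← ht₂]; exact h2u
    · rintro ⟨t, ⟨⟨ht1, -⟩, hc₁, hc₂⟩, rfl, rfl⟩
      have ht0 : t ≠ 0 := by omega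
      refine ⟨⟨⟨Nat.pos_of_ne_zero (mul_ne_zero hd₁0 (mul_ne_zero he₁0 ht0)), hc₁⟩,
        ⟨Nat.pos_of_ne_zero (mul_ne_zero hd₂0 (mul_ne_zero he₂0 ht0)), hc₂⟩⟩,
        Dvd.intro _ rfl, Dvd.intro _ rfl, ?_⟩
      exact line_cond hd₁ hd₂ hd₁0 hd₂0 t
  rw [← Finset.sum_product' (f := fun n₁ n₂ ↦
      if d₁ ∣ n₁ ∧ d₂ ∣ n₂ ∧ a * n₁ / d₁ ^ 2 = b * n₂ / d₂ ^ 2 then F n₁ n₂ else 0),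
    ← Finset.sum_filter, himage, Finset.sum_image (fun s _ t _ h ↦ hg_inj h)]

/-- **§1 (per pair). The boxed Hecke–Petersson diagonal of a mollifier pair `(a, b)` in line coordinates**: for
`a, b ≠ 0` and any weight `F`,
`Σ_{n₁,n₂ ≤ N} F(n₁,n₂) Σ_{d₁∣(a,n₁)} Σ_{d₂∣(b,n₂)} δ(a n₁/d₁², b n₂/d₂²) = Σ_{d₁∣a} Σ_{d₂∣b} Σ_{t : d₁e₁t, d₂e₂t ≤ N} F(d₁e₁t, d₂e₂t)`
(`e₁ = (b/d₂)/c`, `e₂ = (a/d₁)/c`, `c = gcd(a/d₁, b/d₂)`; KMV's substitution (23) with the Hecke divisors kept).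
[cite: KowalskiMichelVanderKam2000, (23) p. 13 — derivation] -/
theorem sum_pair_box_diag_eq_lines {a b : ℕ} (ha : a ≠ 0) (hb : b ≠ 0) (N : ℕ) (F : ℕ → ℕ → ℂ) :
    ∑ n₁ ∈ Icc 1 N, ∑ n₂ ∈ Icc 1 N, F n₁ n₂ *
        ∑ d₁ ∈ (a.gcd n₁).divisors, ∑ d₂ ∈ (b.gcd n₂).divisors, diagKernel (a * n₁ / d₁ ^ 2) (b * n₂ / d₂ ^ 2) =
      ∑ d₁ ∈ a.divisors, ∑ d₂ ∈ b.divisors,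
        ∑ t ∈ (Icc 1 N).filter (fun t ↦ d₁ * ((b / d₂ / (a / d₁).gcd (b / d₂)) * t) ≤ N ∧
            d₂ * ((a / d₁ / (a / d₁).gcd (b / d₂)) * t) ≤ N),
          F (d₁ * ((b / d₂ / (a / d₁).gcd (b / d₂)) * t)) (d₂ * ((a / d₁ / (a / d₁).gcd (b / d₂)) * t)) := by
  classical
  -- open the count into indicators and distribute `F`
  have hstep : ∀ n₁ n₂ : ℕ, F n₁ n₂ *
      ∑ d₁ ∈ (a.gcd n₁).divisors, ∑ d₂ ∈ (b.gcd n₂).divisors, diagKernel (a * n₁ / d₁ ^ 2) (b * n₂ / d₂ ^ 2) =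
      ∑ d₁ ∈ a.divisors, ∑ d₂ ∈ b.divisors,
        (if d₁ ∣ n₁ ∧ d₂ ∣ n₂ ∧ a * n₁ / d₁ ^ 2 = b * n₂ / d₂ ^ 2 then F n₁ n₂ else 0) := by
    intro n₁ n₂
    rw [sum_gcd_divisors_diagKernel_eq ha hb, Finset.mul_sum]
    refine Finset.sum_congr rfl fun d₁ _ ↦ ?_
    rw [Finset.mul_sum]
    refine Finset.sum_congr rfl fun d₂ _ ↦ ?_
    split_ifs <;> simp
  simp_rw [hstep]
  -- exchange `(n₁, n₂)` with `(d₁, d₂)`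
  calc ∑ n₁ ∈ Icc 1 N, ∑ n₂ ∈ Icc 1 N, ∑ d₁ ∈ a.divisors, ∑ d₂ ∈ b.divisors,
          (if d₁ ∣ n₁ ∧ d₂ ∣ n₂ ∧ a * n₁ / d₁ ^ 2 = b * n₂ / d₂ ^ 2 then F n₁ n₂ else 0)
      = ∑ n₁ ∈ Icc 1 N, ∑ d₁ ∈ a.divisors, ∑ n₂ ∈ Icc 1 N, ∑ d₂ ∈ b.divisors,
          (if d₁ ∣ n₁ ∧ d₂ ∣ n₂ ∧ a * n₁ / d₁ ^ 2 = b * n₂ / d₂ ^ 2 then F n₁ n₂ else 0) :=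
        Finset.sum_congr rfl fun _ _ ↦ Finset.sum_comm
    _ = ∑ d₁ ∈ a.divisors, ∑ n₁ ∈ Icc 1 N, ∑ n₂ ∈ Icc 1 N, ∑ d₂ ∈ b.divisors,
          (if d₁ ∣ n₁ ∧ d₂ ∣ n₂ ∧ a * n₁ / d₁ ^ 2 = b * n₂ / d₂ ^ 2 then F n₁ n₂ else 0) := Finset.sum_comm
    _ = ∑ d₁ ∈ a.divisors, ∑ n₁ ∈ Icc 1 N, ∑ d₂ ∈ b.divisors, ∑ n₂ ∈ Icc 1 N,
          (if d₁ ∣ n₁ ∧ d₂ ∣ n₂ ∧ a * n₁ / d₁ ^ 2 = b * n₂ / d₂ ^ 2 then F n₁ n₂ else 0) :=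
        Finset.sum_congr rfl fun _ _ ↦ Finset.sum_congr rfl fun _ _ ↦ Finset.sum_comm
    _ = ∑ d₁ ∈ a.divisors, ∑ d₂ ∈ b.divisors, ∑ n₁ ∈ Icc 1 N, ∑ n₂ ∈ Icc 1 N,
          (if d₁ ∣ n₁ ∧ d₂ ∣ n₂ ∧ a * n₁ / d₁ ^ 2 = b * n₂ / d₂ ^ 2 then F n₁ n₂ else 0) :=
        Finset.sum_congr rfl fun _ _ ↦ Finset.sum_comm
    _ = _ := by
        refine Finset.sum_congr rfl fun d₁ hd₁ ↦ Finset.sum_congr rfl fun d₂ hd₂ ↦ ?_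
        exact sum_box_ite_line_eq ha hb (Nat.mem_divisors.mp hd₁).1 (Nat.mem_divisors.mp hd₂).1 N F

/-! ## §2. The order-`(i, j)` weight along a line, in closed real form -/

/-- **§2. The order-`(i,j)` AFE weight along a diagonal line, in closed real form.** For `q̂ > 0`, `a, b ≠ 0`, `d₁ ∣ a`,
`d₂ ∣ b`, `t ≥ 1`, with `c = gcd(a/d₁, b/d₂)`, `e₁ = (b/d₂)/c`, `e₂ = (a/d₁)/c`, `K = (a/c)(b/c)` and `n₁ = d₁e₁t`, `n₂ = d₂e₂t`:
`(n₁n₂)^{−1/2} · W_{ij}(q̂; n₁, n₂) = c (ab)^{−1/2} t⁻¹ · 𝒲_{ij}(log(q̂/(d₁e₁)) − log t, log(q̂/(d₂e₂)) − log t; K t²/q̂²)`,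
`𝒲_{ij} = KMV2000.logCutoffW i j` (real). At `i = j = 0` this is the summand of `PeterssonSplit.hasSum_afeWeight_line`.
[cite: KowalskiMichelVanderKam2000, (21)–(23) p. 12–13 — derivation] -/
theorem weight_line_eq_logCutoffW {qh : ℝ} (hqh : 0 < qh) (i j : ℕ) {a b d₁ d₂ : ℕ} (ha : a ≠ 0) (hb : b ≠ 0)
    (hd₁ : d₁ ∣ a) (hd₂ : d₂ ∣ b) {t : ℕ} (ht : t ≠ 0) :
    (((((d₁ * ((b / d₂ / (a / d₁).gcd (b / d₂)) * t) : ℕ) : ℝ) *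
          ((d₂ * ((a / d₁ / (a / d₁).gcd (b / d₂)) * t) : ℕ) : ℝ)) ^ (-(1 / 2 : ℝ)) : ℝ) : ℂ) *
        KMV2000.afeW qh i j (d₁ * ((b / d₂ / (a / d₁).gcd (b / d₂)) * t)) (d₂ * ((a / d₁ / (a / d₁).gcd (b / d₂)) * t)) =
      ((((a / d₁).gcd (b / d₂) : ℝ) * ((a : ℝ) * b) ^ (-(1 / 2 : ℝ)) * (t : ℝ)⁻¹ *
          KMV2000.logCutoffW i j
            (Real.log (qh / ((d₁ * (b / d₂ / (a / d₁).gcd (b / d₂)) : ℕ) : ℝ)) - Real.log t)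
            (Real.log (qh / ((d₂ * (a / d₁ / (a / d₁).gcd (b / d₂)) : ℕ) : ℝ)) - Real.log t)
            ((((a / (a / d₁).gcd (b / d₂)) * (b / (a / d₁).gcd (b / d₂)) : ℕ) : ℝ) * (t : ℝ) ^ 2 / qh ^ 2) : ℝ) :
        ℂ) := by
  have hd₁0 : d₁ ≠ 0 := fun h ↦ ha (Nat.eq_zero_of_zero_dvd (h ▸ hd₁))
  have hd₂0 : d₂ ≠ 0 := fun h ↦ hb (Nat.eq_zero_of_zero_dvd (h ▸ hd₂))
  have ha₁0 : a / d₁ ≠ 0 := fun h ↦ ha (Nat.eq_zero_of_dvd_of_div_eq_zero hd₁ h)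
  have ha₂0 : b / d₂ ≠ 0 := fun h ↦ hb (Nat.eq_zero_of_dvd_of_div_eq_zero hd₂ h)
  have hc0 : (a / d₁).gcd (b / d₂) ≠ 0 := (Nat.gcd_pos_of_pos_left _ (Nat.pos_of_ne_zero ha₁0)).ne'
  have hca : (a / d₁).gcd (b / d₂) ∣ a := (Nat.gcd_dvd_left _ _).trans (Nat.div_dvd_of_dvd hd₁)
  have hcb : (a / d₁).gcd (b / d₂) ∣ b := (Nat.gcd_dvd_right _ _).trans (Nat.div_dvd_of_dvd hd₂)
  have he₁0 : b / d₂ / (a / d₁).gcd (b / d₂) ≠ 0 := fun h ↦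
    ha₂0 (Nat.eq_zero_of_dvd_of_div_eq_zero (Nat.gcd_dvd_right _ _) h)
  have he₂0 : a / d₁ / (a / d₁).gcd (b / d₂) ≠ 0 := fun h ↦
    ha₁0 (Nat.eq_zero_of_dvd_of_div_eq_zero (Nat.gcd_dvd_left _ _) h)
  have hn₁ : d₁ * ((b / d₂ / (a / d₁).gcd (b / d₂)) * t) ≠ 0 := mul_ne_zero hd₁0 (mul_ne_zero he₁0 ht)
  have hn₂ : d₂ * ((a / d₁ / (a / d₁).gcd (b / d₂)) * t) ≠ 0 := mul_ne_zero hd₂0 (mul_ne_zero he₂0 ht)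
  have hK0 : (a / (a / d₁).gcd (b / d₂)) * (b / (a / d₁).gcd (b / d₂)) ≠ 0 :=
    mul_ne_zero (fun h ↦ ha (Nat.eq_zero_of_dvd_of_div_eq_zero hca h))
      (fun h ↦ hb (Nat.eq_zero_of_dvd_of_div_eq_zero hcb h))
  have hc0' : (0 : ℝ) < ((a / d₁).gcd (b / d₂) : ℕ) := by exact_mod_cast Nat.pos_of_ne_zero hc0
  have hKr : ((((a / (a / d₁).gcd (b / d₂)) * (b / (a / d₁).gcd (b / d₂)) : ℕ)) : ℝ) =
      (a : ℝ) * b / (((a / d₁).gcd (b / d₂) : ℕ) : ℝ) ^ 2 := by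
    rw [Nat.cast_mul, Nat.cast_div hca (by exact_mod_cast hc0), Nat.cast_div hcb (by exact_mod_cast hc0)]
    field_simp
  have ht0 : (0 : ℝ) < t := by exact_mod_cast Nat.pos_of_ne_zero ht
  have hab : (0 : ℝ) < (a : ℝ) * b := by
    have : (0 : ℝ) < a := by exact_mod_cast Nat.pos_of_ne_zero ha
    have : (0 : ℝ) < b := by exact_mod_cast Nat.pos_of_ne_zero hb
    positivity
  -- the product along the line
  have hprod : ((d₁ * ((b / d₂ / (a / d₁).gcd (b / d₂)) * t) : ℕ) : ℝ) *
        ((d₂ * ((a / d₁ / (a / d₁).gcd (b / d₂)) * t) : ℕ) : ℝ) =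
      ((((a / (a / d₁).gcd (b / d₂)) * (b / (a / d₁).gcd (b / d₂)) : ℕ)) : ℝ) * (t : ℝ) ^ 2 := by
    rw [← Nat.cast_mul, line_prod hd₁ hd₂ t]; push_cast; ring
  -- the two logarithms
  have hde₁ : (0 : ℝ) < ((d₁ * (b / d₂ / (a / d₁).gcd (b / d₂)) : ℕ) : ℝ) := by
    exact_mod_cast Nat.pos_of_ne_zero (mul_ne_zero hd₁0 he₁0)
  have hde₂ : (0 : ℝ) < ((d₂ * (a / d₁ / (a / d₁).gcd (b / d₂)) : ℕ) : ℝ) := by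
    exact_mod_cast Nat.pos_of_ne_zero (mul_ne_zero hd₂0 he₂0)
  have hlog₁ : Real.log (qh / ((d₁ * ((b / d₂ / (a / d₁).gcd (b / d₂)) * t) : ℕ) : ℝ)) =
      Real.log (qh / ((d₁ * (b / d₂ / (a / d₁).gcd (b / d₂)) : ℕ) : ℝ)) - Real.log t := by
    rw [show ((d₁ * ((b / d₂ / (a / d₁).gcd (b / d₂)) * t) : ℕ) : ℝ) =
        ((d₁ * (b / d₂ / (a / d₁).gcd (b / d₂)) : ℕ) : ℝ) * t by push_cast; ring,
      ← div_div, Real.log_div (div_pos hqh hde₁).ne' ht0.ne']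
  have hlog₂ : Real.log (qh / ((d₂ * ((a / d₁ / (a / d₁).gcd (b / d₂)) * t) : ℕ) : ℝ)) =
      Real.log (qh / ((d₂ * (a / d₁ / (a / d₁).gcd (b / d₂)) : ℕ) : ℝ)) - Real.log t := by
    rw [show ((d₂ * ((a / d₁ / (a / d₁).gcd (b / d₂)) * t) : ℕ) : ℝ) =
        ((d₂ * (a / d₁ / (a / d₁).gcd (b / d₂)) : ℕ) : ℝ) * t by push_cast; ring,
      ← div_div, Real.log_div (div_pos hqh hde₂).ne' ht0.ne']
  -- the power
  have hpow : (((d₁ * ((b / d₂ / (a / d₁).gcd (b / d₂)) * t) : ℕ) : ℝ) *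
        ((d₂ * ((a / d₁ / (a / d₁).gcd (b / d₂)) * t) : ℕ) : ℝ)) ^ (-(1 / 2 : ℝ)) =
      (((a / d₁).gcd (b / d₂) : ℕ) : ℝ) * ((a : ℝ) * b) ^ (-(1 / 2 : ℝ)) * (t : ℝ)⁻¹ := by
    rw [hprod, hKr, Real.mul_rpow (by positivity) (by positivity), Real.div_rpow hab.le (by positivity),
      ← Real.rpow_natCast (t : ℝ) 2, ← Real.rpow_mul ht0.le, ← Real.rpow_natCast (((a / d₁).gcd (b / d₂) : ℕ) : ℝ) 2,
      ← Real.rpow_mul hc0'.le]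
    norm_num
    rw [Real.rpow_neg_one, Real.rpow_neg_one]
    field_simp
  rw [KMV2000.afeW_eq_logCutoffW hqh i j hn₁ hn₂, ← Complex.ofReal_mul, hpow, hlog₁, hlog₂, hprod]

/-! ## §3. `diagPart` in line coordinates -/

/-- Exchange of the AFE pair sum with the mollifier pair sum (bookkeeping). -/
theorem sum_sum_mul_sum_sum_comm (s t : Finset ℕ) (F : ℕ → ℕ → ℂ) (G : ℕ → ℕ → ℂ) (H : ℕ → ℕ → ℕ → ℕ → ℂ) :
    ∑ n₁ ∈ s, ∑ n₂ ∈ s, F n₁ n₂ * ∑ m₁ ∈ t, ∑ m₂ ∈ t, G m₁ m₂ * H m₁ m₂ n₁ n₂ =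
      ∑ m₁ ∈ t, ∑ m₂ ∈ t, G m₁ m₂ * ∑ n₁ ∈ s, ∑ n₂ ∈ s, F n₁ n₂ * H m₁ m₂ n₁ n₂ := by
  simp_rw [Finset.mul_sum]
  calc ∑ n₁ ∈ s, ∑ n₂ ∈ s, ∑ m₁ ∈ t, ∑ m₂ ∈ t, F n₁ n₂ * (G m₁ m₂ * H m₁ m₂ n₁ n₂)
      = ∑ n₁ ∈ s, ∑ m₁ ∈ t, ∑ n₂ ∈ s, ∑ m₂ ∈ t, F n₁ n₂ * (G m₁ m₂ * H m₁ m₂ n₁ n₂) :=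
        Finset.sum_congr rfl fun _ _ ↦ Finset.sum_comm
    _ = ∑ m₁ ∈ t, ∑ n₁ ∈ s, ∑ n₂ ∈ s, ∑ m₂ ∈ t, F n₁ n₂ * (G m₁ m₂ * H m₁ m₂ n₁ n₂) := Finset.sum_comm
    _ = ∑ m₁ ∈ t, ∑ n₁ ∈ s, ∑ m₂ ∈ t, ∑ n₂ ∈ s, F n₁ n₂ * (G m₁ m₂ * H m₁ m₂ n₁ n₂) :=
        Finset.sum_congr rfl fun _ _ ↦ Finset.sum_congr rfl fun _ _ ↦ Finset.sum_comm
    _ = ∑ m₁ ∈ t, ∑ m₂ ∈ t, ∑ n₁ ∈ s, ∑ n₂ ∈ s, F n₁ n₂ * (G m₁ m₂ * H m₁ m₂ n₁ n₂) :=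
        Finset.sum_congr rfl fun _ _ ↦ Finset.sum_comm
    _ = _ := by
        refine Finset.sum_congr rfl fun m₁ _ ↦ Finset.sum_congr rfl fun m₂ _ ↦
          Finset.sum_congr rfl fun n₁ _ ↦ Finset.sum_congr rfl fun n₂ _ ↦ ?_
        ring

/-- **§3. THE DIAGONAL PART IN LINE COORDINATES (KMV (23), every order, box exact).** For every level `q`, all `P, Q, Δ'`
(`M = q̂^{Δ'}`, `ℓ = log q̂`, `x_m = KMV2000.mollifierCoeff P M m`):
`diagPart q P Q Δ' = Σ_{i,j ≤ deg Q} QᵢQⱼ ℓ^{−(i+j)} (1+(−1)^{i+j}) q̂ · Σ_{m₁,m₂ ≤ M} x_{m₁}x_{m₂}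
  Σ_{d₁∣m₁} Σ_{d₂∣m₂} Σ_{1 ≤ t ≤ q² : d₁e₁t, d₂e₂t ≤ q²} (n₁n₂)^{−1/2} W_{ij}(q̂; n₁, n₂)|_{n₁ = d₁e₁t, n₂ = d₂e₂t}`,
`e₁ = (m₂/d₂)/c`, `e₂ = (m₁/d₁)/c`, `c = gcd(m₁/d₁, m₂/d₂)` — the `(n₁, n₂)`-box sum of deck 21a's `spectralSum` against the
diagonal kernel collapses onto KMV's lines. With §2 every summand is an explicit real number.
[cite: KowalskiMichelVanderKam2000, (23) p. 13 — derivation] -/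
theorem diagPart_eq_sum_lines (q : ℕ) [NeZero q] (P Q : ℝ[X]) (Δ' : ℝ) :
    diagPart q P Q Δ' =
      ∑ i ∈ range (Q.natDegree + 1), ∑ j ∈ range (Q.natDegree + 1),
        (Q.coeff i : ℂ) * (Q.coeff j : ℂ) * (((Real.log (KMV2000.qhat q))⁻¹ : ℝ) : ℂ) ^ (i + j) *
          (1 + (-1 : ℂ) ^ (i + j)) * (KMV2000.qhat q : ℂ) *
        ∑ m₁ ∈ Icc 1 ⌊KMV2000.qhat q ^ Δ'⌋₊, ∑ m₂ ∈ Icc 1 ⌊KMV2000.qhat q ^ Δ'⌋₊,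
          (KMV2000.mollifierCoeff P (KMV2000.qhat q ^ Δ') m₁ : ℂ) *
            (KMV2000.mollifierCoeff P (KMV2000.qhat q ^ Δ') m₂ : ℂ) *
          ∑ d₁ ∈ m₁.divisors, ∑ d₂ ∈ m₂.divisors,
            ∑ t ∈ (Icc 1 (q ^ 2)).filter (fun t ↦ d₁ * ((m₂ / d₂ / (m₁ / d₁).gcd (m₂ / d₂)) * t) ≤ q ^ 2 ∧
                d₂ * ((m₁ / d₁ / (m₁ / d₁).gcd (m₂ / d₂)) * t) ≤ q ^ 2),
              (((((d₁ * ((m₂ / d₂ / (m₁ / d₁).gcd (m₂ / d₂)) * t) : ℕ) : ℝ) *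
                    ((d₂ * ((m₁ / d₁ / (m₁ / d₁).gcd (m₂ / d₂)) * t) : ℕ) : ℝ)) ^ (-(1 / 2 : ℝ)) : ℝ) : ℂ) *
                KMV2000.afeW (KMV2000.qhat q) i j
                  (d₁ * ((m₂ / d₂ / (m₁ / d₁).gcd (m₂ / d₂)) * t)) (d₂ * ((m₁ / d₁ / (m₁ / d₁).gcd (m₂ / d₂)) * t)) := by
  unfold diagPart spectralSum afeBox
  refine Finset.sum_congr rfl fun i _ ↦ Finset.sum_congr rfl fun j _ ↦ ?_
  simp only [afeW_eq_kmv]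
  congr 1
  rw [sum_sum_mul_sum_sum_comm]
  refine Finset.sum_congr rfl fun m₁ hm₁ ↦ Finset.sum_congr rfl fun m₂ hm₂ ↦ ?_
  have hm₁0 : m₁ ≠ 0 := by have := (Finset.mem_Icc.mp hm₁).1; omega
  have hm₂0 : m₂ ≠ 0 := by have := (Finset.mem_Icc.mp hm₂).1; omega
  congr 1
  exact sum_pair_box_diag_eq_lines hm₁0 hm₂0 (q ^ 2) _

end Summit.Parity.GeneralizedHardyLittlewood.Theorems.MomentsBeyondDiagonal.DiagLines

end
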